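import Summits.QuantumFields.QCD.Theses.SpectralDefectExtinction
import Literature.MathematicalPhysics.QuantumFieldTheory.SpectralDefectDensity
import Literature.MathematicalPhysics.QuantumFieldTheory.QCD
import Summits.QuantumFields.QCD.Theorems.SpectralDefectExtinctionWindowExtinctionChessboardGeometryBlocks
import Summits.QuantumFields.QCD.Theorems.SpectralDefectExtinctionWindowExtinctionChessboardGeometryKato

/-!
# Stub `stub_katoBudgetRadius` (S1, the Kato budget-versus-radius lever) of line
# `kato-radius-collective-defects`
(crux `Summit.QuantumFields.QCD.Theses.SpectralDefectExtinction.WindowExtinction`, item stmt-QuantumFields-8964;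
shared with the chessboard line's geometry helpers and the card depth-participation-floor)

**Statement.**  There is an absolute `c₀ > 0` (here `c₀ = 1/1024`) such that on every four-torus of side
`L`, for every `SU(3)` link field `U`, every non-zero one-flavour vector `v` with Wilson energy
`Re⟨v, D_W(U,0,1) v⟩ ≤ t‖v‖²` carrying at least `9/10` of its mass in the box of radius `R` about `c`
(`IsBoxLocalised v (torusBox L c R) (1/10)`), with `8(R+1) ≤ L`, one has `t ≥ c₀/(R+1)²`:
sub-edge modes are COLLECTIVE objects.

**Proof.**  Let `W(x) = Σ_{a,α} |v(x,a,α)|²` be the site weight and `b = √W` the site amplitude, of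
total mass `M = ‖v‖² > 0`.
* Kato (tree: `ChessboardColdCells.kato_amplitude_le_two_re_wilsonDirac`, i.e. Wilson positivity
  `stub_positivity` + the sitewise diamagnetic inequality `stub_diamagnetic`): the FREE Dirichlet energy
  of `b` is `E(b) = Σ_{x,μ} (b(x+μ̂) − b(x))² ≤ 2 Re⟨v,Dv⟩ ≤ 2tM`.
* Localisation: `Σ_{x ∈ torusBox} W(x) = boxMass ≥ (9/10) M ≥ M/2`.
* If `t < λ := 1/(1024 (R+1)²)` then `E(b) ≤ 2λM` with `16·4·k²·λ = 1` for the block side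
  `k = 4(R+1)`, so the dense-block selection lemma (tree:
  `ChessboardColdCells.exists_block_of_energy`, Markov + box Poincaré summed over translates) yields a
  block `t₀ + {0,…,k−1}⁴` meeting the box in at least `k⁴/16 = (2R+2)⁴` points `s`.  But `k ≤ L`, so
  `s ↦ t₀ + s` is injective and the block meets `torusBox L c R` in at most
  `#torusBox ≤ #box = (2R+1)⁴ < (2R+2)⁴` points — a contradiction.  Hence `t ≥ 1/(1024 (R+1)²)`.

Everything leaned on is proved in the tree (the two chessboard geometry modules, `SpectralDefectDensity`)
or in Mathlib; no named facts, no new definitions.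
-/

namespace Summit.QuantumFields.QCD.Cruxes.WindowExtinction.KatoRadiusCollectiveDefects

open Literature.MathematicalPhysics Literature.MathematicalPhysics.QuantumLattice
  Literature.MathematicalPhysics.QuantumFieldTheory Literature.Probability.LatticeModels
open scoped Matrix
open Summit.QuantumFields.QCD.Cruxes.WindowExtinction.ChessboardColdCells
  (exists_block_of_energy kato_amplitude_le_two_re_wilsonDirac)

noncomputable section

/-- The mass of `v` on a set of sites `B`, as a sum of the site weights
`W(x) = Σ_{a,α} |v(x,a,α)|²` over the sites of `B`. -/
theorem boxMass_eq_sum_filter_siteWeight {L : ℕ} [NeZero L] (v : QuarkIdx L → ℂ)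
    (B : Finset (TorusSite 4 L)) :
    boxMass v B = ∑ x ∈ Finset.univ.filter (fun x : TorusSite 4 L => x ∈ B),
      ∑ a : Fin 3, ∑ α : Fin 4, ‖v (x, a, α)‖ ^ 2 := by
  unfold boxMass
  rw [Finset.sum_filter, Finset.sum_filter, Fintype.sum_prod_type]
  refine Finset.sum_congr rfl fun x _ => ?_
  by_cases hx : x ∈ B
  · simp [hx, Fintype.sum_prod_type]
  · simp [hx]

/-- **S1 · `stub_katoBudgetRadius`** (Kato budget versus localisation radius, `c₀ = 1/1024`). -/
theorem stub_katoBudgetRadius :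
    ∃ c₀ : ℝ, 0 < c₀ ∧ ∀ (L : ℕ) [NeZero L] (U : GaugeConfig 4 L SU3) (v : QuarkIdx L → ℂ) (t : ℝ)
      (c : _root_.Literature.Probability.LatticeModels.Site 4) (R : ℕ), v ≠ 0 → 8 * (R + 1) ≤ L →
      (star v ⬝ᵥ (wilsonDirac (fundamentalRep (Fin 3)) U 0 1 *ᵥ v)).re ≤ t * ∑ i, ‖v i‖ ^ 2 →
      IsBoxLocalised v (torusBox L c R) (1 / 10) → c₀ / ((R : ℝ) + 1) ^ 2 ≤ t := by
  refine ⟨1 / 1024, by norm_num, ?_⟩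
  intro L _ U v t c R hv hRL hRe hloc
  by_contra! hlt
  -- the site weight `W` and the site amplitude `b = √W`
  set W : TorusSite 4 L → ℝ := fun x => ∑ a : Fin 3, ∑ α : Fin 4, ‖v (x, a, α)‖ ^ 2 with hWdef
  set b : TorusSite 4 L → ℝ := fun x => Real.sqrt (W x) with hbdef
  have hWnn : ∀ x, 0 ≤ W x := fun x =>
    Finset.sum_nonneg fun _ _ => Finset.sum_nonneg fun _ _ => sq_nonneg _
  have hWb : ∀ x, W x = b x ^ 2 := fun x => (Real.sq_sqrt (hWnn x)).symm
  have hM : ∑ i, ‖v i‖ ^ 2 = ∑ x, W x := by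
    simp only [hWdef, Fintype.sum_prod_type]
  have hMpos : 0 < ∑ i, ‖v i‖ ^ 2 := by
    by_contra! hle
    apply hv
    funext i
    have h0 := (Finset.sum_eq_zero_iff_of_nonneg (fun i _ => sq_nonneg ‖v i‖)).mp
      (le_antisymm hle (Finset.sum_nonneg fun i _ => sq_nonneg ‖v i‖)) i (Finset.mem_univ i)
    simpa using h0
  -- Kato: the free Dirichlet energy of the amplitude is at most `2 Re⟨v, Dv⟩`
  have hE : ∑ x : TorusSite 4 L, ∑ μ : Fin 4, (b (QuantumFieldTheory.Site.shift x μ) - b x) ^ 2 ≤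
      2 * (star v ⬝ᵥ (wilsonDirac (fundamentalRep (Fin 3)) U 0 1 *ᵥ v)).re :=
    kato_amplitude_le_two_re_wilsonDirac L U v
  -- the block side `k = 4(R+1) ≤ L`
  obtain ⟨k, hk⟩ : ∃ k : ℕ, k = 4 * (R + 1) := ⟨_, rfl⟩
  have hk1 : 1 ≤ k := by omega
  have hkL : k ≤ L := by omega
  have hR1 : (0 : ℝ) < (R : ℝ) + 1 := by positivity
  have hkR : (k : ℝ) = 4 * ((R : ℝ) + 1) := by
    rw [hk]; push_cast; ring
  have hlam1 : 16 * ((4 : ℕ) : ℝ) * (k : ℝ) ^ 2 * (1 / 1024 / ((R : ℝ) + 1) ^ 2) ≤ 1 := by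
    rw [hkR]
    have h : 16 * ((4 : ℕ) : ℝ) * (4 * ((R : ℝ) + 1)) ^ 2 * (1 / 1024 / ((R : ℝ) + 1) ^ 2) = 1 := by
      push_cast
      field_simp
      ring
    exact h.le
  -- energy hypothesis of the dense-block selection
  have hD : ∑ x : TorusSite 4 L, ∑ μ : Fin 4, (b (QuantumFieldTheory.Site.shift x μ) - b x) ^ 2 ≤
      2 * (1 / 1024 / ((R : ℝ) + 1) ^ 2) * ∑ x, W x := by
    rw [← hM]
    have h1 := mul_le_mul_of_nonneg_right hlt.le hMpos.le
    nlinarith [hE, hRe, h1]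
  -- mass hypothesis of the dense-block selection: at least half of the mass sits in the box
  have hG : ∑ x, W x ≤
      2 * ∑ x ∈ Finset.univ.filter (fun x : TorusSite 4 L => x ∈ torusBox L c R), W x := by
    have h2 : ∑ x ∈ Finset.univ.filter (fun x : TorusSite 4 L => x ∈ torusBox L c R), W x =
        boxMass v (torusBox L c R) := (boxMass_eq_sum_filter_siteWeight v _).symm
    have hloc' : (1 - 1 / 10) * ∑ i, ‖v i‖ ^ 2 ≤ boxMass v (torusBox L c R) := hloc
    rw [h2, ← hM]
    linarith
  have hpos : 0 < ∑ x, W x := hM ▸ hMpos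
  obtain ⟨t₀, hcard, -⟩ := exists_block_of_energy (d := 4) (L := L) k hk1 W b
    (fun x : TorusSite 4 L => x ∈ torusBox L c R) (1 / 1024 / ((R : ℝ) + 1) ^ 2) hWb hpos hG hD hlam1
  -- the block does not wrap: `s ↦ t₀ + s` is injective on `{0,…,k-1}⁴`
  have hinj : Function.Injective fun s : Fin 4 → Fin k => t₀ + fun μ => ((s μ : ℕ) : ZMod L) := by
    intro s s' h
    have h' := add_left_cancel h
    funext μ
    have hμ := congr_fun h' μ
    apply Fin.ext
    have hv1 := congr_arg ZMod.val hμ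
    rwa [ZMod.val_cast_of_lt (lt_of_lt_of_le (s μ).isLt hkL),
      ZMod.val_cast_of_lt (lt_of_lt_of_le (s' μ).isLt hkL)] at hv1
  -- so it meets the box in at most `#torusBox ≤ (2R+1)⁴` points
  have hcount : ∀ S : Finset (Fin 4 → Fin k),
      (∀ s ∈ S, (t₀ + fun μ => ((s μ : ℕ) : ZMod L)) ∈ torusBox L c R) →
        (S.card : ℝ) ≤ (2 * (R : ℝ) + 1) ^ 4 := by
    intro S hS
    have h1 : S.card ≤ (torusBox L c R).card :=
      Finset.card_le_card_of_injOn (fun s : Fin 4 → Fin k => t₀ + fun μ => ((s μ : ℕ) : ZMod L))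
        (fun s hs => hS s hs) (hinj.injOn)
    have h2 : (torusBox L c R).card ≤ (2 * R + 1) ^ 4 := by
      unfold torusBox
      exact Finset.card_image_le.trans (card_box 4 R).le
    have h3 := (Nat.cast_le (α := ℝ)).mpr (h1.trans h2)
    push_cast at h3
    exact h3
  have hle : (k : ℝ) ^ 4 / 16 ≤ (2 * (R : ℝ) + 1) ^ 4 :=
    calc (k : ℝ) ^ 4 / 16 ≤ _ := hcard
      _ ≤ (2 * (R : ℝ) + 1) ^ 4 := hcount _ fun s hs => (Finset.mem_filter.mp hs).2
  -- contradiction: `k⁴/16 = (2R+2)⁴ > (2R+1)⁴`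
  rw [hkR] at hle
  have hlt4 : (2 * (R : ℝ) + 1) ^ 4 < (2 * (R : ℝ) + 2) ^ 4 :=
    pow_lt_pow_left₀ (by linarith) (by positivity) (by norm_num)
  have heq : (4 * ((R : ℝ) + 1)) ^ 4 / 16 = (2 * (R : ℝ) + 2) ^ 4 := by ring
  linarith

end

end Summit.QuantumFields.QCD.Cruxes.WindowExtinction.KatoRadiusCollectiveDefects
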